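/-
Origin: expansion seat `planner-pub-hodgecm-pv14-0`, handover v5 2026-08-18T04:21:13Z (`HOME/pub-hodgecm-pv14/lean/Pv14/PerL34/P36FD.lean`, md5 399a676f, 396 lines);
landed by the gen-5 packager in gate run 21 as `HodgeCM/PerL34/P36_fd.lean` (import ^import Pv[0-9]+copy\.(?:PerL34\.)?→import HodgeCM.PerL34. ×1; import ^import Pv14\.PerL34\.P36Bridge\b→import HodgeCM.PerL34.P36_bridge ×1).
-/
/-
Origin: HOME/pub-hodgecm-pv14/lean/Pv14/PerL34/P36FD.lean — session planner-pub-hodgecm-pv14-0 (unit pub-hodgecm-pv14, node N23b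
holder).  Intended final place: `HodgeCM/PerL34/P36_fd.lean`, after `P36_bridge.lean` (pv14) and pv05's
`KernelOperatorFD.lean` (here `import Pv05copy.KernelOperatorFD` = byte-identical local copy of pv05's handed-over file
md5 e9717d63; PACKAGER: rewrite the two `Pv…` imports to the landed module names, do not land the copies).
N23b with the dictionary D7 INSTANTIATED: `𝒯_Φ` and `ϑ_{T,χ}` are DEFINED as pv05's kernel operators on
`L²([U(W)]) = Lp ℂ 2 (dh.restrict 𝓕)` resp. `L²([T])`, composed with `ι = ContinuousMap.toLp : C([G_U]) → L²([G_U])`,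
and `E^χ_f` as the `L²` class of the function `Σ_γ Ψ(γ·)`; the DEFINITIONAL binders `hTι/hTev/hϑι/hϑev` of
`P36Bridge.unfoldingIdentity_of` are then theorems (`rfl` / pv05 `evalT_toLp`).  KERNEL; nothing asserted.
v2–v4 add, all KERNEL: `continuous_ϑc_omg` / `integrable_test` / `N23b_fd'` (N18 for Step 1 from joint continuity of
`θ_Φ`); `Step1Data.omegaPreservesKappa_of_commute` (binder `hκ`: `κ` a character, commuting dual-pair actions);
`hθω_of_weil` (binder `hθω` DEFINITIONAL); section `Esum` + `Eseries` / `hasSum_Eseries` / `memLp_Eseries` (`E^χ_f`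
DEFINED as the finite sum `Σ_γ Ψ(γ·)`, binder `hE` and the field `Regular.E_memLp`) and `N23b_fd''`.
-/
import Summits.HodgeConjecture.HodgeCM.PerL34.P36_unfolding
import Summits.HodgeConjecture.HodgeCM.PerL34.P36_bridge
import Summits.HodgeConjecture.HodgeCM.PerL34.KernelOperatorFD

/-! PORT of `HodgeCM/PerL34/P36_fd.lean` (HodgeCMPerL run 82) — verbatim mechanical port; provenance in the PORT header line. -/

set_option autoImplicit false

open MeasureTheory
open scoped Pointwise

namespace HodgeCM.PerL34.P36Unfolding.Step1Data

variable {Gw Hw H SK Ch : Type*} [MeasurableSpace Gw] [NormedAddCommGroup Hw] [InnerProductSpace ℂ Hw]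
  [NormedAddCommGroup H] [InnerProductSpace ℂ H] (D : Step1Data Gw Hw H SK Ch)

/-- **Binder `hκ` from commuting actions (tex l. 343–344, 418).** `κ = ∧²𝔭₊ ⊠ 1` is a CHARACTER of `K_∞`
(`𝔭₊ ≅ ℂ²` for `U(2,1)`, so `∧²𝔭₊` is one-dimensional), hence the `κ`-isotypic subspace `𝒮^κ` of `ω|_{K_∞}` is
the `κ`-eigenspace; the Weil-representation actions of the two members `U(W)(𝔸)` and `K_∞ ⊂ G_U(𝔸)` of the dual
pair commute (PRINT: `ω` is a representation of `U(W)(𝔸) × G_U(𝔸)`, tex l. 342), so `ω(h)𝒮^κ ⊆ 𝒮^κ` and in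
particular `ω(h)Φ ∈ 𝒮^κ` for `Φ ∈ 𝒮^κ` — pure linear algebra, KERNEL. -/
theorem omegaPreservesKappa_of_commute [AddCommGroup SK] [Module ℂ SK] {Kc : Type*}
    (ρ : Kc → SK →ₗ[ℂ] SK) (κ : Kc → ℂ) (hS : ∀ Φ', Φ' ∈ D.Sκ ↔ ∀ k, ρ k Φ' = κ k • Φ')
    (ω : Gw → SK →ₗ[ℂ] SK) (hω : ∀ h Φ', D.omg h Φ' = ω h Φ')
    (hcomm : ∀ h k Φ', ρ k (ω h Φ') = ω h (ρ k Φ')) (hΦ : D.Φ ∈ D.Sκ) : D.OmegaPreservesKappa := by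
  intro h
  rw [hS]
  intro k
  rw [hω, hcomm, (hS D.Φ).1 hΦ k, map_smul]

end HodgeCM.PerL34.P36Unfolding.Step1Data

namespace HodgeCM
namespace PerL34
namespace P36FD

section Esum
variable {U T : Type*} [Group U] [TopologicalSpace U] [IsTopologicalGroup U] [Group T] [MeasurableSpace T]
  (ν : Measure T) (jT : T →* U) (𝓕T : Set T) (Γ : Subgroup U)

omit [IsTopologicalGroup U] in
/-- If `Ψ^χ_f(γ y) ≠ 0` then `γ ∈ jT(𝓕T) · supp f · y⁻¹`. -/
theorem mem_of_Psi_ne_zero {C : Set U} (hjC : Set.MapsTo jT 𝓕T C) (f : U → ℂ) (χ : T → ℂ) (γ y : U)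
    (hγ : P36Unfold.Psi ν jT 𝓕T f χ (γ * y) ≠ 0) : γ ∈ C * tsupport f * {y⁻¹} := by
  by_contra hnot
  apply hγ
  apply setIntegral_eq_zero_of_forall_eq_zero
  intro t ht
  have hzero : f ((jT t)⁻¹ * (γ * y)) = 0 := by
    by_contra hne
    apply hnot
    have hs : (jT t)⁻¹ * (γ * y) ∈ tsupport f := subset_tsupport _ hne
    exact Set.mem_mul.2 ⟨γ * y, Set.mem_mul.2 ⟨jT t, hjC ht, _, hs, by group⟩, y⁻¹, rfl, by group⟩
  simp [hzero]

/-- For `f ∈ C_c(U(W)(𝔸))`, `Γ = U(W)(L₀)` discrete and closed, and `jT(𝓕T)` inside a compact set, only finitely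
many `γ ∈ Γ` have `Ψ^χ_f(γ y) ≠ 0`, uniformly for `y` in a compact set `D`. -/
theorem support_Psi_subset [DiscreteTopology Γ] (hΓ : IsClosed (Γ : Set U)) {C : Set U} (hC : IsCompact C)
    (hjC : Set.MapsTo jT 𝓕T C) {f : U → ℂ} (hf : HasCompactSupport f) (χ : T → ℂ) {D : Set U}
    (hD : IsCompact D) :
    ∃ F₀ : Finset Γ, ∀ y ∈ D, (Function.support fun γ : Γ => P36Unfold.Psi ν jT 𝓕T f χ ((γ : U) * y)) ⊆ F₀ := by
  have hK : IsCompact (C * tsupport f * D⁻¹) := (hC.mul hf).mul hD.inv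
  have hfin : ((C * tsupport f * D⁻¹) ∩ (Γ : Set U)).Finite := by
    refine (hK.inter_right hΓ).finite ?_
    exact (SetLike.isDiscrete_iff_discreteTopology.2 ‹DiscreteTopology Γ›).mono Set.inter_subset_right
  refine ⟨(hfin.preimage Subtype.val_injective.injOn).toFinset, fun y hy γ hγ => ?_⟩
  simp only [Set.Finite.coe_toFinset, Set.mem_preimage]
  refine ⟨?_, γ.2⟩
  have h1 := mem_of_Psi_ne_zero ν jT 𝓕T hjC f χ (γ : U) y hγ
  exact Set.mul_subset_mul_left (Set.singleton_subset_iff.2 (Set.inv_mem_inv.2 hy)) h1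

/-- (Ported verbatim from the HodgeCMPerL package; no docstring in the source.) -/
theorem support_Psi_finite [DiscreteTopology Γ] (hΓ : IsClosed (Γ : Set U)) {C : Set U} (hC : IsCompact C)
    (hjC : Set.MapsTo jT 𝓕T C) {f : U → ℂ} (hf : HasCompactSupport f) (χ : T → ℂ) (y : U) :
    (Function.support fun γ : Γ => P36Unfold.Psi ν jT 𝓕T f χ ((γ : U) * y)).Finite := by
  obtain ⟨F₀, hF₀⟩ := support_Psi_subset ν jT 𝓕T Γ hΓ hC hjC hf χ isCompact_singleton
  exact F₀.finite_toSet.subset (hF₀ y rfl)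

/-- **Binder `hE` KERNEL**: `E^χ_f(y) := Σ_{γ ∈ Γ} Ψ^χ_f(γ y)` (tex ll. 407–409) is a finite sum, hence `HasSum`. -/
theorem hasSum_Psi [DiscreteTopology Γ] (hΓ : IsClosed (Γ : Set U)) {C : Set U} (hC : IsCompact C)
    (hjC : Set.MapsTo jT 𝓕T C) {f : U → ℂ} (hf : HasCompactSupport f) (χ : T → ℂ) (y : U) :
    HasSum (fun γ : Γ => P36Unfold.Psi ν jT 𝓕T f χ ((γ : U) * y))
      (∑' γ : Γ, P36Unfold.Psi ν jT 𝓕T f χ ((γ : U) * y)) :=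
  (summable_of_hasFiniteSupport (support_Psi_finite ν jT 𝓕T Γ hΓ hC hjC hf χ y)).hasSum

variable [MeasurableSpace U] [OpensMeasurableSpace U] [MeasurableInv U] [MeasurableMul₂ U]
  [FirstCountableTopology U]

/-- `y ↦ Ψ^χ_f(z y)` is continuous for `f ∈ C_c`, `χ` bounded measurable (dominated convergence on `[T]`). -/
theorem continuous_Psi [IsFiniteMeasure (ν.restrict 𝓕T)] (hjT : Measurable jT) {f : U → ℂ} (hf : Continuous f)
    (hfc : HasCompactSupport f) {χ : T → ℂ} (hχm : Measurable χ) (hχb : ∀ t, ‖χ t‖ ≤ 1) (z : U) :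
    Continuous fun y => P36Unfold.Psi ν jT 𝓕T f χ (z * y) := by
  obtain ⟨B, hB⟩ := hf.bounded_above_of_compact_support hfc
  have hB0 : 0 ≤ B := (norm_nonneg _).trans (hB 1)
  unfold P36Unfold.Psi
  refine continuous_of_dominated (μ := ν.restrict 𝓕T) (bound := fun _ => B * 1) ?_ ?_ (integrable_const _) ?_
  · intro y
    exact ((hf.measurable.comp ((hjT.inv).mul_const _)).mul hχm).aestronglyMeasurable
  · intro y
    exact ae_of_all _ fun t => by rw [norm_mul]; exact mul_le_mul (hB _) (hχb t) (norm_nonneg _) hB0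
  · exact ae_of_all _ fun t =>
      (hf.comp (continuous_const.mul (continuous_const.mul continuous_id))).mul continuous_const

/-- **`E^χ_f ∈ L²(𝓕)` KERNEL** for `f ∈ C_c(U(W)(𝔸))` and a fundamental domain `𝓕` inside a compact set (as is the
case for anisotropic `U(W)`, tex l. 384): `E^χ_f` is a bounded continuous finite sum on `𝓕`. -/
theorem memLp_E (μ : Measure U) (𝓕 : Set U) [IsFiniteMeasure (μ.restrict 𝓕)] (h𝓕m : MeasurableSet 𝓕)
    {D : Set U} (hD : IsCompact D) (h𝓕D : 𝓕 ⊆ D) [IsFiniteMeasure (ν.restrict 𝓕T)] (hjT : Measurable jT)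
    [DiscreteTopology Γ] (hΓ : IsClosed (Γ : Set U)) {C : Set U} (hC : IsCompact C) (hjC : Set.MapsTo jT 𝓕T C)
    {f : U → ℂ} (hf : Continuous f) (hfc : HasCompactSupport f) {χ : T → ℂ} (hχm : Measurable χ)
    (hχb : ∀ t, ‖χ t‖ ≤ 1) :
    MemLp (fun y => ∑' γ : Γ, P36Unfold.Psi ν jT 𝓕T f χ ((γ : U) * y)) 2 (μ.restrict 𝓕) := by
  obtain ⟨B, hB⟩ := hf.bounded_above_of_compact_support hfc
  have hB0 : 0 ≤ B := (norm_nonneg _).trans (hB 1)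
  obtain ⟨F₀, hF₀⟩ := support_Psi_subset ν jT 𝓕T Γ hΓ hC hjC hfc χ hD
  have hE_eq : ∀ y ∈ D, ∑' γ : Γ, P36Unfold.Psi ν jT 𝓕T f χ ((γ : U) * y) =
      ∑ γ ∈ F₀, P36Unfold.Psi ν jT 𝓕T f χ ((γ : U) * y) := fun y hy => tsum_eq_sum' (hF₀ y hy)
  have hcont : Continuous fun y => ∑ γ ∈ F₀, P36Unfold.Psi ν jT 𝓕T f χ ((γ : U) * y) :=
    continuous_finsetSum F₀ fun γ _ => continuous_Psi ν jT 𝓕T hjT hf hfc hχm hχb (γ : U)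
  have hae : (fun y => ∑ γ ∈ F₀, P36Unfold.Psi ν jT 𝓕T f χ ((γ : U) * y)) =ᵐ[μ.restrict 𝓕]
      (fun y => ∑' γ : Γ, P36Unfold.Psi ν jT 𝓕T f χ ((γ : U) * y)) := by
    filter_upwards [ae_restrict_mem h𝓕m] with y hy
    exact (hE_eq y (h𝓕D hy)).symm
  have h𝓕T : ν 𝓕T < ⊤ := by
    rw [← Measure.restrict_apply_univ]; exact measure_lt_top _ _
  have hΨb : ∀ z, ‖P36Unfold.Psi ν jT 𝓕T f χ z‖ ≤ B * 1 * ν.real 𝓕T := fun z => by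
    unfold P36Unfold.Psi
    refine norm_setIntegral_le_of_norm_le_const h𝓕T fun t _ => ?_
    rw [norm_mul]; exact mul_le_mul (hB _) (hχb t) (norm_nonneg _) hB0
  refine MemLp.of_bound (hcont.aestronglyMeasurable.congr hae) (F₀.card * (B * 1 * ν.real 𝓕T)) ?_
  filter_upwards [ae_restrict_mem h𝓕m] with y hy
  rw [hE_eq y (h𝓕D hy)]
  refine (norm_sum_le _ _).trans ?_
  calc ∑ γ ∈ F₀, ‖P36Unfold.Psi ν jT 𝓕T f χ ((γ : U) * y)‖
      ≤ ∑ γ ∈ F₀, B * 1 * ν.real 𝓕T := Finset.sum_le_sum fun γ _ => hΨb _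
    _ = F₀.card * (B * 1 * ν.real 𝓕T) := by simp [Finset.sum_const, nsmul_eq_mul]

end Esum


/-- The data of the fundamental-domain model of Prop 3.6 Step 1 (everything a genuine function / measure; the
only non-definitional content is carried by the HYPOTHESES of `N23b_fd` below). -/
structure FDModel where
  /-- `U(W)(𝔸)` -/
  U : Type
  [iU₁ : Group U] [iU₂ : MeasurableSpace U] [iU₃ : MeasurableMul₂ U] [iU₄ : MeasurableInv U]
  /-- Haar measure `dh` -/
  μ : Measure U
  [iμ₁ : μ.IsMulLeftInvariant] [iμ₂ : SFinite μ]
  /-- `U(W)(L₀)` -/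
  Γ : Subgroup U
  [iΓ : Countable Γ]
  /-- a fundamental domain `[U(W)]` of finite measure -/
  𝓕 : Set U
  [i𝓕 : IsFiniteMeasure (μ.restrict 𝓕)]
  /-- `T(𝔸)` -/
  T : Type
  [iT₁ : Group T] [iT₂ : MeasurableSpace T] [iT₃ : MeasurableMul₂ T]
  /-- Haar measure on `T(𝔸)` and the fundamental domain `[T]` -/
  ν : Measure T
  [iν : SFinite ν]
  𝓕T : Set T
  [i𝓕T : IsFiniteMeasure (ν.restrict 𝓕T)]
  /-- `T(𝔸) → U(W)(𝔸)` -/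
  jT : T →* U
  /-- `[G_U]` (compact) with its finite invariant measure -/
  K : Type
  [iK₁ : TopologicalSpace K] [iK₂ : CompactSpace K] [iK₃ : FirstCountableTopology K]
  [iK₄ : MeasurableSpace K] [iK₅ : BorelSpace K]
  μK : Measure K
  [iμK : IsFiniteMeasure μK]
  /-- Schwartz functions `𝒮`, the fixed `Φ`, `ω(h)`, `𝒮^κ` -/
  SK : Type
  Φ : SK
  omg : U → SK → SK
  Sκ : Set SK
  /-- the theta kernel `θ_{Φ'}(g, y)` and its sup bound `C Φ'` (depending on `Φ'`: `θ` is linear in `Φ'`, so a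
  bound uniform in `Φ'` would make `Regular` unsatisfiable for `SK` a vector space — v5 fix) -/
  θ : SK → K → U → ℂ
  C : SK → ℝ
  /-- characters `χ` of `[T]` as functions, and which are allowed -/
  Ch : Type
  χc : Ch → T → ℂ
  allowed : Ch → Prop
  /-- test functions and `E^χ_f` as a function on `U(W)(𝔸)` -/
  Test : Set (U → ℂ)
  Efun : Ch → (U → ℂ) → (U → ℂ)

attribute [instance] FDModel.iU₁ FDModel.iU₂ FDModel.iU₃ FDModel.iU₄ FDModel.iμ₁ FDModel.iμ₂ FDModel.iΓ
  FDModel.i𝓕 FDModel.iT₁ FDModel.iT₂ FDModel.iT₃ FDModel.iν FDModel.i𝓕T FDModel.iK₁ FDModel.iK₂ FDModel.iK₃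
  FDModel.iK₄ FDModel.iK₅ FDModel.iμK

namespace FDModel

variable (P : FDModel)

/-- Regularity HYPOTHESES on the data (all ANALYTIC, none a PerL claim): the theta kernels are bounded,
continuous on `[G_U]`, measurable on `U(W)(𝔸)`; `jT` measurable; characters bounded measurable; `E^χ_f ∈ L²([U(W)])`. -/
structure Regular : Prop where
  kernel : ∀ Φ', KernelOperatorFD.IsFDKernel (P.θ Φ') (P.C Φ')
  jT_meas : Measurable P.jT
  χ_meas : ∀ χ, Measurable (P.χc χ)
  χ_bound : ∀ χ t, ‖P.χc χ t‖ ≤ 1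
  E_memLp : ∀ χ f, MemLp (P.Efun χ f) 2 (P.μ.restrict P.𝓕)

variable {P}

/-- the theta kernel restricted to `[G_U] × T(𝔸)` is again an FD-kernel -/
theorem kernelT (hP : P.Regular) (Φ' : P.SK) :
    KernelOperatorFD.IsFDKernel (fun g t => P.θ Φ' g (P.jT t)) (P.C Φ') where
  cont t := (hP.kernel Φ').cont (P.jT t)
  meas g := ((hP.kernel Φ').meas g).comp hP.jT_meas
  nonneg := (hP.kernel Φ').nonneg
  bound g t := (hP.kernel Φ').bound g (P.jT t)

/-- a bounded measurable character is in `L²([T])` -/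
theorem χ_memLp (hP : P.Regular) (χ : P.Ch) : MemLp (P.χc χ) 2 (P.ν.restrict P.𝓕T) :=
  MemLp.of_bound (hP.χ_meas χ).aestronglyMeasurable 1 (ae_of_all _ (hP.χ_bound χ))

/-- `ι : C([G_U]) → L²([G_U])` -/
noncomputable def ι (P : FDModel) : C(P.K, ℂ) →L[ℂ] Lp ℂ 2 P.μK := ContinuousMap.toLp (E := ℂ) 2 P.μK ℂ

/-- **D7 instantiated — `ϑ_{T,χ}(Φ')` as a genuine element of `C([G_U])`**: `g ↦ ∫_{[T]} θ_{Φ'}(g,t) χ(t) dt`. -/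
noncomputable def ϑc (hP : P.Regular) (χ : P.Ch) (Φ' : P.SK) : C(P.K, ℂ) :=
  KernelOperatorFD.opTC (P.ν.restrict P.𝓕T) (kernelT hP Φ') ((χ_memLp hP χ).toLp _)

/-- **D7 instantiated — the `Step1Data` of `P36_unfolding`** with `𝒯_Φ := ι ∘ (v ↦ ∫_{[U(W)]} θ_Φ(·,y) v(y) dy)`
(pv05 `opT`), `ϑ := ι ∘ ϑc`, `E^χ_f :=` the `L²` class of `Efun χ f`. -/
@[reducible] noncomputable def step1 (hP : P.Regular) : P36Unfolding.Step1Data P.U (Lp ℂ 2 (P.μ.restrict P.𝓕)) (Lp ℂ 2 P.μK) P.SK P.Ch where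
  dh := P.μ
  TΦ := KernelOperatorFD.opT (P.μ.restrict P.𝓕) P.μK (hP.kernel P.Φ)
  Φ := P.Φ
  omg := P.omg
  Sκ := P.Sκ
  ϑ χ Φ' := ι P (ϑc hP χ Φ')
  Test := P.Test
  E χ f := (hP.E_memLp χ f).toLp _
  allowed := P.allowed

/-- (Ported verbatim from the HodgeCMPerL package; no docstring in the source.) -/
theorem ϑc_apply (hP : P.Regular) (χ : P.Ch) (Φ' : P.SK) (g : P.K) :
    ϑc hP χ Φ' g = ∫ t in P.𝓕T, P.θ Φ' g (P.jT t) * P.χc χ t ∂P.ν := by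
  exact KernelOperatorFD.evalT_toLp (k := fun g t => P.θ Φ' g (P.jT t)) (P.ν.restrict P.𝓕T) (χ_memLp hP χ) g

/-- **N23b in the fundamental-domain model, D7 instantiated.** Remaining hypotheses: `hθω` (definition of
`ω(h)` on kernels, l. 418), `hE` (definition of `E^χ_f`, ll. 407–409), `hθΓ` (automorphy of the theta kernel,
N10), `hTest` (test functions are measurable and integrable), `hF` (N18: Bochner integrability of
`h ↦ f(h) • ϑ_{T,χ}(ω(h)Φ)`, pv11), `hκ` (`ω(h)Φ ∈ 𝒮^κ`). -/
theorem N23b_fd (hP : P.Regular) (𝓕dom : IsFundamentalDomain P.Γ P.𝓕 P.μ)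
    (hθω : ∀ h g y, P.θ (P.omg h P.Φ) g y = P.θ P.Φ g (y * h))
    (hE : ∀ χ, ∀ f ∈ P.Test, ∀ y,
      HasSum (fun γ : P.Γ => P36Unfold.Psi P.ν P.jT P.𝓕T f (P.χc χ) ((γ : P.U) * y)) (P.Efun χ f y))
    (hθΓ : ∀ g (γ : P.Γ) z, P.θ P.Φ g ((γ : P.U) * z) = P.θ P.Φ g z)
    (hTest : ∀ f ∈ P.Test, Measurable f ∧ Integrable f P.μ)
    (hF : ∀ χ, ∀ f ∈ P.Test, Integrable (fun h => f h • ϑc hP χ (P.omg h P.Φ)) P.μ)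
    (hκ : (step1 hP).OmegaPreservesKappa) : (step1 hP).N23b_statement := by
  have h𝓕T : P.ν P.𝓕T < ⊤ := by
    simpa using measure_lt_top (P.ν.restrict P.𝓕T) Set.univ
  refine P36Bridge.N23b_of_model (step1 hP) P.ν P.jT hP.jT_meas P.Γ 𝓕dom P.𝓕T h𝓕T (ι P) P.θ P.χc (ϑc hP)
    (fun χ f => KernelOperatorFD.opTC (P.μ.restrict P.𝓕) (hP.kernel P.Φ) ((hP.E_memLp χ f).toLp _)) P.Efun
    (fun χ f _ => rfl) ?_ (fun χ Φ' => rfl) (fun χ Φ' g => ϑc_apply hP χ Φ' g) hθω hE hθΓ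
    (fun g => (hP.kernel P.Φ).meas g) (fun g => ⟨P.C P.Φ, fun z => (hP.kernel P.Φ).bound g z⟩) hP.χ_meas hP.χ_bound
    hTest hF hκ
  intro χ f _ g
  exact KernelOperatorFD.evalT_toLp (k := P.θ P.Φ) (P.μ.restrict P.𝓕) (hP.E_memLp χ f) g

/-- **Binder `hθω` is DEFINITIONAL (D4)**: if the kernel is the theta kernel of a representation `ω` of
`G_U(𝔸) × U(W)(𝔸)` on `𝒮` — `θ_{Φ'}(g, y) = Θ(ω(s g, y)Φ')` for the theta distribution `Θ` and any set-theoretic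
lift `s : [G_U] → G_U(𝔸)` (tex l. 342, 394) — and `ω(h) := ω(1, h)` (l. 418), then
`θ_{ω(h)Φ}(g, y) = θ_Φ(g, y h)` is the representation property, KERNEL. -/
theorem hθω_of_weil {G : Type*} [Monoid G] [MulAction (G × P.U) P.SK] (Θ : P.SK → ℂ) (s : P.K → G)
    (hθ : ∀ Φ' g y, P.θ Φ' g y = Θ ((s g, y) • Φ')) (homg : ∀ h Φ', P.omg h Φ' = ((1 : G), h) • Φ') :
    ∀ h g y, P.θ (P.omg h P.Φ) g y = P.θ P.Φ g (y * h) := by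
  intro h g y
  rw [hθ, hθ, homg, ← mul_smul, Prod.mk_mul_mk, mul_one]

/-- **N18 for Step 1, KERNEL in this model**: if the theta kernel `θ_Φ` is jointly continuous on `[G_U] × U(W)(𝔸)`
(PRINT: Weil 1964 [Acta Math. 111, doi:10.1007/BF02391012], Théorème 6 (n°41, p. 193) + Lemme 5 (p. 194): `Θ(S) = Σ_{ξ∈X_k}
(SΦ)(ξ)` is continuous on `Mp(X)_A`; `(S,Φ) ↦ SΦ` continuous: n°39, p. 189; PerL l. 394; GAPS adv1g5-O5), then `h ↦ ϑ_{T,χ}(ω(h)Φ)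
∈ C([G_U])` is continuous (dominated convergence on the finite measure space `[T]`, then currying; no compactness of `[T]`). -/
theorem continuous_ϑc_omg (hP : P.Regular) [TopologicalSpace P.U] [ContinuousMul P.U]
    [FirstCountableTopology P.U]
    (hθω : ∀ h g y, P.θ (P.omg h P.Φ) g y = P.θ P.Φ g (y * h))
    (hθc : Continuous (Function.uncurry (P.θ P.Φ))) (χ : P.Ch) :
    Continuous (fun h => ϑc hP χ (P.omg h P.Φ)) := by
  apply ContinuousMap.continuous_of_continuous_uncurry
  have hfun : (Function.uncurry fun h g => ϑc hP χ (P.omg h P.Φ) g) =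
      fun p : P.U × P.K => ∫ t in P.𝓕T, P.θ P.Φ p.2 (P.jT t * p.1) * P.χc χ t ∂P.ν := by
    ext ⟨h, g⟩
    simp only [Function.uncurry_apply_pair, ϑc_apply, hθω]
  rw [hfun]
  refine continuous_of_dominated (bound := fun _ => P.C P.Φ * 1) ?_ ?_ ?_ ?_
  · intro p
    exact ((((hP.kernel P.Φ).meas p.2).comp (hP.jT_meas.mul_const p.1)).mul (hP.χ_meas χ)).aestronglyMeasurable
  · intro p
    refine ae_of_all _ (fun t => ?_)
    rw [norm_mul]
    exact mul_le_mul ((hP.kernel P.Φ).bound _ _) (hP.χ_bound χ t) (norm_nonneg _) (hP.kernel P.Φ).nonneg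
  · exact integrable_const _
  · refine ae_of_all _ (fun t => ?_)
    exact (hθc.comp (continuous_snd.prodMk (continuous_const.mul continuous_fst))).mul continuous_const

/-- Hence the Bochner-integrability hypothesis `hF` of `N23b_fd` for test functions `f ∈ C_c(U(W)(𝔸))`. -/
theorem integrable_test (hP : P.Regular) [TopologicalSpace P.U] [ContinuousMul P.U]
    [FirstCountableTopology P.U] [OpensMeasurableSpace P.U] [IsFiniteMeasureOnCompacts P.μ]
    (hθω : ∀ h g y, P.θ (P.omg h P.Φ) g y = P.θ P.Φ g (y * h))
    (hθc : Continuous (Function.uncurry (P.θ P.Φ))) (χ : P.Ch) {f : P.U → ℂ} (hf : Continuous f)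
    (hfc : HasCompactSupport f) : Integrable (fun h => f h • ϑc hP χ (P.omg h P.Φ)) P.μ :=
  P36Bridge.integrable_test_smul P.μ hf hfc (continuous_ϑc_omg hP hθω hθc χ)

/-- **N23b in the fundamental-domain model, D7 instantiated AND N18 discharged**: for test functions in
`C_c(U(W)(𝔸))` and a jointly continuous theta kernel, the remaining hypotheses are `hθω`, `hE`, `hθΓ` (N10), `hκ`
and the fundamental domain. -/
theorem N23b_fd' (hP : P.Regular) [TopologicalSpace P.U] [ContinuousMul P.U] [FirstCountableTopology P.U]
    [OpensMeasurableSpace P.U] [IsFiniteMeasureOnCompacts P.μ]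
    (𝓕dom : IsFundamentalDomain P.Γ P.𝓕 P.μ)
    (hθω : ∀ h g y, P.θ (P.omg h P.Φ) g y = P.θ P.Φ g (y * h))
    (hθc : Continuous (Function.uncurry (P.θ P.Φ)))
    (hE : ∀ χ, ∀ f ∈ P.Test, ∀ y,
      HasSum (fun γ : P.Γ => P36Unfold.Psi P.ν P.jT P.𝓕T f (P.χc χ) ((γ : P.U) * y)) (P.Efun χ f y))
    (hθΓ : ∀ g (γ : P.Γ) z, P.θ P.Φ g ((γ : P.U) * z) = P.θ P.Φ g z)
    (hTest : ∀ f ∈ P.Test, Continuous f ∧ HasCompactSupport f)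
    (hκ : (step1 hP).OmegaPreservesKappa) : (step1 hP).N23b_statement :=
  N23b_fd hP 𝓕dom hθω hE hθΓ
    (fun f hf => ⟨(hTest f hf).1.measurable, (hTest f hf).1.integrable_of_hasCompactSupport (hTest f hf).2⟩)
    (fun χ f hf => integrable_test hP hθω hθc χ (hTest f hf).1 (hTest f hf).2) hκ

/-- **The DEFINITION of `E^χ_f` as a function** (tex ll. 407–409): `E^χ_f(y) := Σ_{γ ∈ U(W)(L₀)} Ψ^χ_f(γ y)`
for `f ∈ C_c(U(W)(𝔸))` (a finite sum, `hasSum_Psi`), extended by `0` to non-test functions so that the datum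
`Efun` of an `FDModel` can be taken to be `Eseries`. -/
noncomputable def Eseries [TopologicalSpace P.U] (χ : P.Ch) (f : P.U → ℂ) (y : P.U) : ℂ := by
  classical
  exact if Continuous f ∧ HasCompactSupport f then
    ∑' γ : P.Γ, P36Unfold.Psi P.ν P.jT P.𝓕T f (P.χc χ) ((γ : P.U) * y) else 0

/-- (Ported verbatim from the HodgeCMPerL package; no docstring in the source.) -/
theorem Eseries_of_test [TopologicalSpace P.U] (χ : P.Ch) {f : P.U → ℂ} (hf : Continuous f ∧ HasCompactSupport f)
    (y : P.U) : P.Eseries χ f y = ∑' γ : P.Γ, P36Unfold.Psi P.ν P.jT P.𝓕T f (P.χc χ) ((γ : P.U) * y) := by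
  classical
  exact if_pos hf

/-- binder `hE` of `N23b_fd` for `Efun := Eseries`, KERNEL (`Γ` discrete and closed, `jT(𝓕T)` in a compact set). -/
theorem hasSum_Eseries [TopologicalSpace P.U] [IsTopologicalGroup P.U] [DiscreteTopology P.Γ]
    (hΓ : IsClosed (P.Γ : Set P.U)) {C : Set P.U} (hC : IsCompact C) (hjC : Set.MapsTo P.jT P.𝓕T C) (χ : P.Ch)
    {f : P.U → ℂ} (hf : Continuous f ∧ HasCompactSupport f) (y : P.U) :
    HasSum (fun γ : P.Γ => P36Unfold.Psi P.ν P.jT P.𝓕T f (P.χc χ) ((γ : P.U) * y)) (P.Eseries χ f y) := by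
  rw [Eseries_of_test χ hf]
  exact hasSum_Psi P.ν P.jT P.𝓕T P.Γ hΓ hC hjC hf.2 _ y

/-- the field `Regular.E_memLp` for `Efun := Eseries`, KERNEL (fundamental domain `𝓕` measurable and inside a
compact set — anisotropic `U(W)`, tex l. 384). -/
theorem memLp_Eseries [TopologicalSpace P.U] [IsTopologicalGroup P.U] [OpensMeasurableSpace P.U]
    [FirstCountableTopology P.U] [DiscreteTopology P.Γ] (hΓ : IsClosed (P.Γ : Set P.U)) {C : Set P.U}
    (hC : IsCompact C) (hjC : Set.MapsTo P.jT P.𝓕T C) (hjT : Measurable P.jT) (h𝓕m : MeasurableSet P.𝓕)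
    {D : Set P.U} (hD : IsCompact D) (h𝓕D : P.𝓕 ⊆ D) (hχm : ∀ χ, Measurable (P.χc χ))
    (hχb : ∀ χ t, ‖P.χc χ t‖ ≤ 1) (χ : P.Ch) (f : P.U → ℂ) : MemLp (P.Eseries χ f) 2 (P.μ.restrict P.𝓕) := by
  classical
  by_cases hf : Continuous f ∧ HasCompactSupport f
  · have : P.Eseries χ f = fun y => ∑' γ : P.Γ, P36Unfold.Psi P.ν P.jT P.𝓕T f (P.χc χ) ((γ : P.U) * y) :=
      funext fun y => Eseries_of_test χ hf y
    rw [this]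
    exact memLp_E P.ν P.jT P.𝓕T P.Γ P.μ P.𝓕 h𝓕m hD h𝓕D hjT hΓ hC hjC hf.1 hf.2 (hχm χ) (hχb χ)
  · have : P.Eseries χ f = fun _ => 0 := funext fun y => if_neg hf
    rw [this]
    exact memLp_const 0

/-- **N23b in the fundamental-domain model with D7 instantiated, N18 discharged and `E^χ_f` DEFINED**
(`Efun = Eseries`): the named inputs left are `hθω` (DEFINITIONAL, see `hθω_of_weil`), `hθc` (PRINT: continuity of
the theta kernel — Weil 1964, Théorème 6 (n°41, p. 193) + Lemme 5 (p. 194), n°39 (p. 189); GAPS adv1g5-O5), `hθΓ` (N10),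
`hκ` (see `Step1Data.omegaPreservesKappa_of_commute`), the fundamental domains and the topological standing hypotheses
(`Γ = U(W)(L₀)` discrete and closed in `U(W)(𝔸)`, `T(L₀)\T(𝔸)` represented inside a compact set). -/
theorem N23b_fd'' (hP : P.Regular) [TopologicalSpace P.U] [IsTopologicalGroup P.U] [FirstCountableTopology P.U]
    [OpensMeasurableSpace P.U] [IsFiniteMeasureOnCompacts P.μ] [DiscreteTopology P.Γ]
    (hΓ : IsClosed (P.Γ : Set P.U)) {C : Set P.U} (hC : IsCompact C) (hjC : Set.MapsTo P.jT P.𝓕T C)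
    (𝓕dom : IsFundamentalDomain P.Γ P.𝓕 P.μ) (hEdef : ∀ χ f, P.Efun χ f = P.Eseries χ f)
    (hθω : ∀ h g y, P.θ (P.omg h P.Φ) g y = P.θ P.Φ g (y * h))
    (hθc : Continuous (Function.uncurry (P.θ P.Φ)))
    (hθΓ : ∀ g (γ : P.Γ) z, P.θ P.Φ g ((γ : P.U) * z) = P.θ P.Φ g z)
    (hTest : ∀ f ∈ P.Test, Continuous f ∧ HasCompactSupport f)
    (hκ : (step1 hP).OmegaPreservesKappa) : (step1 hP).N23b_statement :=
  N23b_fd' hP 𝓕dom hθω hθc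
    (fun χ f hf y => by rw [hEdef]; exact hasSum_Eseries hΓ hC hjC χ (hTest f hf) y) hθΓ hTest hκ

end FDModel

end P36FD
end PerL34
end HodgeCM
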